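import HarnessLib
import Summits.Ventures.WeilGRH.UniformConductorFloorPrincipal
import Summits.Ventures.WeilGRH.UniformConductorFloorJointFloors
import Summits.Ventures.WeilGRH.OneCompleteMod31
import Summits.Ventures.WeilGRH.OneCompleteMod37
import Summits.Ventures.WeilGRH.OneCompleteMod41
import Summits.Ventures.WeilGRH.OneCompleteMod43
import Summits.Ventures.WeilGRH.OneCompleteMod47
import Summits.Ventures.WeilGRH.OneCompleteMod53
import Summits.Ventures.WeilGRH.OneCompleteMod59
import Summits.Ventures.WeilGRH.OneCompleteMod61
import Summits.Ventures.WeilGRH.OneCompleteMod67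
import Summits.Ventures.WeilGRH.OneCompleteMod71
import Summits.Ventures.WeilGRH.OneCompleteMod73

/-!
# GRH arm (rh-explicit, venture WeilGRH): Weil positivity on `[−1, 1]` for EVERY non-principal Dirichlet character of EVERY
  prime modulus `p ≥ 31`

Cell `rh-explicit`, WEIL TRACK — GRH ARM (engine seat weil-grh-2 gen16).  Pure assembly of the arm's `t = 1` statement for
NON-PRINCIPAL characters of prime moduli:

* `p ≥ 78`: every character (principal included) by the uniform joint-cell floor
  `UniformFloor.weilPositivityOnChar_one_of_ge_78` (weil-grh-1);
* `31 ≤ p ≤ 73` prime (`p = 31, 37, 41, 43, 47, 53, 59, 61, 67, 71, 73`): the per-modulus assemblies `OneCompleteMod<p>`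
  (odd characters by the odd floor `R₁`, real even characters by the real cells / islands, even complex characters by the
  door-C χ-cells `CellsMod<p>One*` of this seat); there is no prime in `74 … 78`.

By `UniformConductorFloorPrincipal.not_weilPositivityOnChar_one_principal_of_prime_le` the principal character of every prime
`p ≤ 73` FAILS Weil positivity on `[−1, 1]`, so for `31 ≤ p ≤ 73` the hypothesis `χ ≠ 1` is necessary and the statement below is
the complete `t = 1` picture for these primes: exactly the principal character fails.  (Primes `p ≤ 29` are open on the odd or
small-conductor side and are not claimed here.)  Pure assembly; RH/GRH-free; standard axioms.
-/

noncomputable section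

namespace Summit.Ventures.WeilGRH.OneCompletePrimesFrom31
open Literature.NumberTheory.LFunctions

/-- ★★ **Every non-principal Dirichlet character of every PRIME modulus `p ≥ 31` satisfies Weil positivity on `[−1, 1]`**
(`WeilPositivityOnChar χ 1`: Weil's hermitian form of `L(s, χ)` is non-negative on every smooth test function supported in
`[−1, 1]`).  For `31 ≤ p ≤ 73` the principal character fails, so `χ ≠ 1` is sharp there.
[cite: Weil1952FormulesExplicites, (11) pp. 261–262 and the «lemme» p. 262] -/
theorem weilPositivityOnChar_one_of_prime_ge_31 {p : ℕ} (hp : p.Prime) (h31 : 31 ≤ p)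
    (χ : DirichletCharacter ℂ p) (hχ : χ ≠ 1) : WeilPositivityOnChar χ 1 := by
  by_cases h78 : 78 ≤ p
  · exact UniformFloor.weilPositivityOnChar_one_of_ge_78 h78 χ
  · have h77 : p ≤ 77 := by omega
    have key : p = 31 ∨ p = 37 ∨ p = 41 ∨ p = 43 ∨ p = 47 ∨ p = 53 ∨ p = 59 ∨ p = 61 ∨ p = 67 ∨ p = 71 ∨ p = 73 := by
      interval_cases p <;> first | decide | norm_num at hp
    rcases key with rfl | rfl | rfl | rfl | rfl | rfl | rfl | rfl | rfl | rfl | rfl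
    · exact OneCompleteMod31.weilPositivityOnChar_mod31_one χ hχ
    · exact OneCompleteMod37.weilPositivityOnChar_mod37_one χ hχ
    · exact OneCompleteMod41.weilPositivityOnChar_mod41_one χ hχ
    · exact OneCompleteMod43.weilPositivityOnChar_mod43_one χ hχ
    · exact OneCompleteMod47.weilPositivityOnChar_mod47_one χ hχ
    · exact OneCompleteMod53.weilPositivityOnChar_mod53_one χ hχ
    · exact OneCompleteMod59.weilPositivityOnChar_mod59_one χ hχ
    · exact OneCompleteMod61.weilPositivityOnChar_mod61_one χ hχ
    · exact OneCompleteMod67.weilPositivityOnChar_mod67_one χ hχ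
    · exact OneCompleteMod71.weilPositivityOnChar_mod71_one χ hχ
    · exact OneCompleteMod73.weilPositivityOnChar_mod73_one χ hχ

/-- ★★ **PRIME MODULI `p ≥ 31`, the exact `t = 1` picture for non-principal characters on every window `t ≤ 1`.** [folklore] -/
theorem weilPositivityOnChar_of_le_one_of_prime_ge_31 {p : ℕ} (hp : p.Prime) (h31 : 31 ≤ p)
    (χ : DirichletCharacter ℂ p) (hχ : χ ≠ 1) {t : ℝ} (ht : t ≤ 1) : WeilPositivityOnChar χ t := fun g hg hsupp ↦
  weilPositivityOnChar_one_of_prime_ge_31 hp h31 χ hχ g hg (hsupp.trans (Set.Icc_subset_Icc (by linarith) ht))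

/-- ★★ **PRIME MODULI `31 ≤ p ≤ 73`: EXACTLY the principal character fails Weil positivity on `[−1, 1]`** —
`WeilPositivityOnChar χ 1 ↔ χ ≠ 1` for every Dirichlet character `χ` mod `p` (failure of the principal character:
`UniformFloor.not_weilPositivityOnChar_one_principal_of_prime_le`; from `p ≥ 79` on every character is positive,
`UniformFloor.forall_weilPositivityOnChar_one_iff_of_prime`). [cite: Weil1952FormulesExplicites, (11) pp. 261–262 and the «lemme» p. 262] -/
theorem weilPositivityOnChar_one_iff_ne_one_of_prime {p : ℕ} (hp : p.Prime) (h31 : 31 ≤ p) (h73 : p ≤ 73)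
    (χ : DirichletCharacter ℂ p) : WeilPositivityOnChar χ 1 ↔ χ ≠ 1 :=
  ⟨fun h h1 ↦ UniformFloor.not_weilPositivityOnChar_one_principal_of_prime_le hp h73 (h1 ▸ h),
   weilPositivityOnChar_one_of_prime_ge_31 hp h31 χ⟩

end Summit.Ventures.WeilGRH.OneCompletePrimesFrom31

end
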